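import Summits.CriticalPhenomena.PercolationContinuityZ3.Theorems.PercNearOneGluingNoHeavyQuantFarTwoHubBlock
import Summits.CriticalPhenomena.PercolationContinuityZ3.Theorems.PercNearOneGluingNoHeavyQuantFarTwoAnchorAlgebra
import Summits.CriticalPhenomena.PercolationContinuityZ3.Theorems.PercNearOneGluingNoHeavyQuantFarBlockTransfer
import HarnessLib

/-!
# QUANT lane R8, front "FAR beyond trees", layer one — TWO-HUB BLOCKS IV: the TWO-HUB TRANSFER theorem and its FAR form
# (a 2-connected block may be replaced by two stems WITHOUT touching what hangs at its anchors)

builds on p205010 (kernel theorem, internal audit signed; external expert review pending)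

Support file (`--supports stmt-CriticalPhenomena-4575`), seat `prim-quant-p1` (gen 19); memo
`run/shared/lean/prim/quant/prim-quant-p1-g19/FOR-LEAD-CACTI.md` §5.  Standard axioms; no sorries; no definitions.

* `Block.real_hub_laws` — law of a loaded hub count;
* **`Block.real_card_le_one_le_twoHub`** — for a two-hub pendant block (`Block.IsTwoHub`: arbitrary core, arbitrary structures `S₁, S₂`
  hanging at the anchors, block relays in `S₁ ∪ S₂ ∪ {v₁, v₂}`, at least one) and its hub-decoupled weights `w'`
  (`Block.hdecouple`): `P_{w'}(N ≤ 1) ≤ t` and `P_w(o ↮ a) ≤ t` on the block relays imply `P_w(N ≤ 1) ≤ t`;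
* `Block.real_openConn_hdecouple_eq` — marginals are preserved; **`Block.farLayerOne_twoHub`** — the `j = 1` FAR instance transfers.
This is the induction step of the cactus theorem: every 2-connected block loaded at ≤ 2 vertices is exchanged for two stems, whatever hangs
below it (memo §5; `…QuantFarLayerOneCactus`).  [cite: Grimmett1999, §1.3 p. 10; Thm. (2.4) p. 34]; the theorems [this work].
-/

noncomputable section

namespace Summit.CriticalPhenomena.PercolationContinuityZ3.Theorems

namespace Quant

namespace Block

open Finset MeasureTheory Set
open Literature.Probability.LatticeModels
open Literature.Probability.Percolation
open Bundle (offZ avoid real_offZ_event_eq_of_agree)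
open scoped Classical

variable {n : ℕ} {o c v₁ v₂ : Fin n} {Z S₁ S₂ : Finset (Fin n)}

/-- Law of a loaded hub count: `P(Y + b ≥ 1) = P(Y + b = 1) + P(Y + b ≥ 2)` and `P(Y + b = 0) = 1 − P(Y + b ≥ 1)`. [folklore] -/
theorem real_hub_laws (μ : Measure (BondConfig (Fin n))) [IsProbabilityMeasure μ] (S : Finset (Fin n)) (v : Fin n) (B : Finset (Fin n)) (b : ℕ) :
    μ.real {ω | 1 ≤ (B.filter fun a => inS S v ω ∈ openConn v a).card + b} =
        μ.real {ω | (B.filter fun a => inS S v ω ∈ openConn v a).card + b = 1} +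
          μ.real {ω | 2 ≤ (B.filter fun a => inS S v ω ∈ openConn v a).card + b} ∧
      μ.real {ω | (B.filter fun a => inS S v ω ∈ openConn v a).card + b = 0} =
        1 - μ.real {ω | 1 ≤ (B.filter fun a => inS S v ω ∈ openConn v a).card + b} := by
  have hmeas : ∀ U : Set (BondConfig (Fin n)), MeasurableSet U := fun U => (Set.toFinite U).measurableSet
  constructor
  · have h := measureReal_inter_add_sdiff (μ := μ) (s := {ω : BondConfig (Fin n) | 1 ≤ (B.filter fun a => inS S v ω ∈ openConn v a).card + b})
      (hmeas {ω | 2 ≤ (B.filter fun a => inS S v ω ∈ openConn v a).card + b})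
    have e1 : {ω : BondConfig (Fin n) | 1 ≤ (B.filter fun a => inS S v ω ∈ openConn v a).card + b} ∩
        {ω | 2 ≤ (B.filter fun a => inS S v ω ∈ openConn v a).card + b} =
        {ω | 2 ≤ (B.filter fun a => inS S v ω ∈ openConn v a).card + b} := by
      ext ω; simp only [Set.mem_inter_iff, mem_setOf_eq]; omega
    have e2 : {ω : BondConfig (Fin n) | 1 ≤ (B.filter fun a => inS S v ω ∈ openConn v a).card + b} \
        {ω | 2 ≤ (B.filter fun a => inS S v ω ∈ openConn v a).card + b} =
        {ω | (B.filter fun a => inS S v ω ∈ openConn v a).card + b = 1} := by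
      ext ω; simp only [Set.mem_sdiff, mem_setOf_eq]; omega
    rw [e1, e2] at h; linarith
  · have e3 : {ω : BondConfig (Fin n) | (B.filter fun a => inS S v ω ∈ openConn v a).card + b = 0} =
        {ω : BondConfig (Fin n) | 1 ≤ (B.filter fun a => inS S v ω ∈ openConn v a).card + b}ᶜ := by
      ext ω; simp only [Set.mem_compl_iff, mem_setOf_eq]; omega
    rw [e3, probReal_compl_eq_one_sub (hmeas _)]

/-- **TWO-HUB TRANSFER.**  For a two-hub pendant block (arbitrary structures `S₁, S₂` hanging at the anchors, block relays in
`S₁ ∪ S₂ ∪ {v₁, v₂}`, at least one) and its hub-decoupled weights `w'`: `P_{w'}(N ≤ 1) ≤ t` and `P_w(o ↮ a) ≤ t` on the block relays imply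
`P_w(N ≤ 1) ≤ t`. [this work] -/
theorem real_card_le_one_le_twoHub (H : IsTwoHub c v₁ v₂ Z S₁ S₂) (w : Sym2 (Fin n) → unitInterval) (ho : o ∉ Z)
    (hwZ : ∀ x y : Fin n, x ≠ y → x ∈ Z → y ∉ Z → y ≠ c → (w s(x, y) : ℝ) = 0)
    (hwS₁ : ∀ x y : Fin n, x ≠ y → x ∈ S₁ → y ∉ S₁ → y ≠ v₁ → (w s(x, y) : ℝ) = 0)
    (hwS₂ : ∀ x y : Fin n, x ≠ y → x ∈ S₂ → y ∉ S₂ → y ≠ v₂ → (w s(x, y) : ℝ) = 0)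
    (A : Finset (Fin n)) (hA : A ∩ Z ⊆ S₁ ∪ S₂ ∪ {v₁, v₂}) (hAZ : (A ∩ Z).Nonempty)
    (t : ℝ) (hcut : ∀ a ∈ A ∩ Z, (prodBernoulli w).real (openConn o a)ᶜ ≤ t)
    (hfar' : (prodBernoulli (hdecouple c v₁ v₂ Z S₁ S₂ w)).real
      {ω : BondConfig (Fin n) | (A.filter fun a => ω ∈ openConn o a).card ≤ 1} ≤ t) :
    (prodBernoulli w).real {ω : BondConfig (Fin n) | (A.filter fun a => ω ∈ openConn o a).card ≤ 1} ≤ t := by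
  set w' := hdecouple c v₁ v₂ Z S₁ S₂ w with hw'
  set μ := prodBernoulli w with hμ
  set μ' := prodBernoulli w' with hμ'
  have hmeas : ∀ U : Set (BondConfig (Fin n)), MeasurableSet U := fun U => (Set.toFinite U).measurableSet
  have hw'S₁ : ∀ x y : Fin n, x ≠ y → x ∈ S₁ → y ∉ S₁ → y ≠ v₁ → (w' s(x, y) : ℝ) = 0 := hdecouple_hub_vanish₁ H w
  have hw'S₂ : ∀ x y : Fin n, x ≠ y → x ∈ S₂ → y ∉ S₂ → y ≠ v₂ → (w' s(x, y) : ℝ) = 0 := hdecouple_hub_vanish₂ H w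
  -- core events and their probabilities
  set E₁ := {ω : BondConfig (Fin n) | core Z (S₁ ∪ S₂) ω ∈ openConn c v₁} with hE₁
  set E₂ := {ω : BondConfig (Fin n) | core Z (S₁ ∪ S₂) ω ∈ openConn c v₂} with hE₂
  set m₁ := μ.real E₁ with hm₁
  set m₂ := μ.real E₂ with hm₂
  set p := μ.real (E₁ ∩ E₂) with hp
  have hm₁0 : 0 ≤ m₁ := measureReal_nonneg
  have hm₂0 : 0 ≤ m₂ := measureReal_nonneg
  have hp₁ : p ≤ m₁ := measureReal_mono Set.inter_subset_left
  have hp₂ : p ≤ m₂ := measureReal_mono Set.inter_subset_right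
  have hpm : m₁ * m₂ ≤ p := prodBernoulli_harris w (isUpperSet_coreReach c v₁ Z (S₁ ∪ S₂)) (isUpperSet_coreReach c v₂ Z (S₁ ∪ S₂)) (hmeas _) (hmeas _)
  have h10 : μ.real (E₁ \ E₂) = m₁ - p := by
    have := measureReal_inter_add_sdiff (μ := μ) (s := E₁) (hmeas E₂); linarith
  have h01 : μ.real (E₂ \ E₁) = m₂ - p := by
    have := measureReal_inter_add_sdiff (μ := μ) (s := E₂) (hmeas E₁); rw [Set.inter_comm] at this; linarith
  have hm₁' : μ'.real E₁ = m₁ := real_coreReach_hdecouple₁ H w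
  have hm₂' : μ'.real E₂ = m₂ := real_coreReach_hdecouple₂ H w
  have hp' : μ'.real (E₁ ∩ E₂) = m₁ * m₂ := real_coreReach_inter_hdecouple H w
  have h10' : μ'.real (E₁ \ E₂) = m₁ - m₁ * m₂ := by
    have := measureReal_inter_add_sdiff (μ := μ') (s := E₁) (hmeas E₂); linarith
  have h01' : μ'.real (E₂ \ E₁) = m₂ - m₁ * m₂ := by
    have := measureReal_inter_add_sdiff (μ := μ') (s := E₂) (hmeas E₁); rw [Set.inter_comm] at this; linarith
  -- hair laws
  set A₁ := A ∩ S₁ with hA₁def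
  set A₂ := A ∩ S₂ with hA₂def
  set b₁ : ℕ := (if v₁ ∈ A then 1 else 0) with hb₁
  set b₂ : ℕ := (if v₂ ∈ A then 1 else 0) with hb₂
  set s₁ := μ.real {ω | ((A₁.filter fun a => inS S₁ v₁ ω ∈ openConn v₁ a).card + b₁) = 1} with hs₁
  set d₁ := μ.real {ω | 2 ≤ ((A₁.filter fun a => inS S₁ v₁ ω ∈ openConn v₁ a).card + b₁)} with hd₁
  set u₁ := μ.real {ω | 1 ≤ ((A₁.filter fun a => inS S₁ v₁ ω ∈ openConn v₁ a).card + b₁)} with hu₁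
  set z₁ := μ.real {ω | ((A₁.filter fun a => inS S₁ v₁ ω ∈ openConn v₁ a).card + b₁) = 0} with hz₁
  set s₂ := μ.real {ω | ((A₂.filter fun a => inS S₂ v₂ ω ∈ openConn v₂ a).card + b₂) = 1} with hs₂
  set d₂ := μ.real {ω | 2 ≤ ((A₂.filter fun a => inS S₂ v₂ ω ∈ openConn v₂ a).card + b₂)} with hd₂
  set u₂ := μ.real {ω | 1 ≤ ((A₂.filter fun a => inS S₂ v₂ ω ∈ openConn v₂ a).card + b₂)} with hu₂
  obtain ⟨hu₁eq, hz₁eq⟩ := real_hub_laws μ S₁ v₁ A₁ b₁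
  obtain ⟨hu₂eq, -⟩ := real_hub_laws μ S₂ v₂ A₂ b₂
  have hu : u₁ = s₁ + d₁ := hu₁eq
  have hz : z₁ = 1 - u₁ := hz₁eq
  have hu' : u₂ = s₂ + d₂ := hu₂eq
  have hs₁0 : 0 ≤ s₁ := measureReal_nonneg
  have hd₁0 : 0 ≤ d₁ := measureReal_nonneg
  have hs₂0 : 0 ≤ s₂ := measureReal_nonneg
  have hd₂0 : 0 ≤ d₂ := measureReal_nonneg
  have hu₁1 : u₁ ≤ 1 := measureReal_le_one
  have hu₂1 : u₂ ≤ 1 := measureReal_le_one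
  -- the same hair laws under `w'`
  have hs₁' : μ'.real {ω | ((A₁.filter fun a => inS S₁ v₁ ω ∈ openConn v₁ a).card + b₁) = 1} = s₁ := real_hub_hdecouple₁ H w A₁ fun k => k + b₁ = 1
  have hd₁' : μ'.real {ω | 2 ≤ ((A₁.filter fun a => inS S₁ v₁ ω ∈ openConn v₁ a).card + b₁)} = d₁ := real_hub_hdecouple₁ H w A₁ fun k => 2 ≤ k + b₁
  have hu₁' : μ'.real {ω | 1 ≤ ((A₁.filter fun a => inS S₁ v₁ ω ∈ openConn v₁ a).card + b₁)} = u₁ := real_hub_hdecouple₁ H w A₁ fun k => 1 ≤ k + b₁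
  have hz₁' : μ'.real {ω | ((A₁.filter fun a => inS S₁ v₁ ω ∈ openConn v₁ a).card + b₁) = 0} = z₁ := real_hub_hdecouple₁ H w A₁ fun k => k + b₁ = 0
  have hd₂' : μ'.real {ω | 2 ≤ ((A₂.filter fun a => inS S₂ v₂ ω ∈ openConn v₂ a).card + b₂)} = d₂ := real_hub_hdecouple₂ H w A₂ fun k => 2 ≤ k + b₂
  have hu₂' : μ'.real {ω | 1 ≤ ((A₂.filter fun a => inS S₂ v₂ ω ∈ openConn v₂ a).card + b₂)} = u₂ := real_hub_hdecouple₂ H w A₂ fun k => 1 ≤ k + b₂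
  -- internal numbers
  set hS := μ.real {ω | 1 ≤ ((A ∩ Z).filter fun a => onZ Z ω ∈ openConn c a).card} with hhS
  set tS := μ.real {ω | 2 ≤ ((A ∩ Z).filter fun a => onZ Z ω ∈ openConn c a).card} with htS
  set hP := μ'.real {ω | 1 ≤ ((A ∩ Z).filter fun a => onZ Z ω ∈ openConn c a).card} with hhP
  set tP := μ'.real {ω | 2 ≤ ((A ∩ Z).filter fun a => onZ Z ω ∈ openConn c a).card} with htP
  have fS : hS = m₁ * (s₁ + d₁) + m₂ * (s₂ + d₂) - p * (s₁ + d₁) * (s₂ + d₂) := by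
    have h := real_one_le_X_eq_hub H w hwS₁ hwS₂ hA
    rw [← hμ] at h
    change hS = μ.real (E₁ \ E₂) * u₁ + μ.real (E₂ \ E₁) * u₂ + μ.real (E₁ ∩ E₂) * u₁ + μ.real (E₁ ∩ E₂) * z₁ * u₂ at h
    rw [h, h10, h01, ← hp, hz, hu, hu']; ring
  have fT : tS = m₁ * d₁ + m₂ * d₂ + p * (s₁ * (s₂ + d₂) - (s₁ + d₁) * d₂) := by
    have h := real_two_le_X_eq_hub H w hwS₁ hwS₂ hA
    rw [← hμ] at h
    change tS = μ.real (E₁ \ E₂) * d₁ + μ.real (E₂ \ E₁) * d₂ + μ.real (E₁ ∩ E₂) * d₁ + μ.real (E₁ ∩ E₂) * s₁ * u₂ +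
      μ.real (E₁ ∩ E₂) * z₁ * d₂ at h
    rw [h, h10, h01, ← hp, hz, hu, hu']; ring
  have fP : hP = m₁ * (s₁ + d₁) + m₂ * (s₂ + d₂) - m₁ * m₂ * (s₁ + d₁) * (s₂ + d₂) := by
    have h := real_one_le_X_eq_hub H w' hw'S₁ hw'S₂ hA
    rw [← hμ'] at h
    change hP = μ'.real (E₁ \ E₂) * μ'.real {ω | 1 ≤ ((A₁.filter fun a => inS S₁ v₁ ω ∈ openConn v₁ a).card + b₁)} +
      μ'.real (E₂ \ E₁) * μ'.real {ω | 1 ≤ ((A₂.filter fun a => inS S₂ v₂ ω ∈ openConn v₂ a).card + b₂)} +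
      μ'.real (E₁ ∩ E₂) * μ'.real {ω | 1 ≤ ((A₁.filter fun a => inS S₁ v₁ ω ∈ openConn v₁ a).card + b₁)} +
      μ'.real (E₁ ∩ E₂) * μ'.real {ω | ((A₁.filter fun a => inS S₁ v₁ ω ∈ openConn v₁ a).card + b₁) = 0} *
        μ'.real {ω | 1 ≤ ((A₂.filter fun a => inS S₂ v₂ ω ∈ openConn v₂ a).card + b₂)} at h
    rw [h, h10', h01', hp', hu₁', hu₂', hz₁', hz, hu, hu']; ring
  have fQ : tP = m₁ * d₁ + m₂ * d₂ + m₁ * m₂ * (s₁ * (s₂ + d₂) - (s₁ + d₁) * d₂) := by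
    have h := real_two_le_X_eq_hub H w' hw'S₁ hw'S₂ hA
    rw [← hμ'] at h
    change tP = μ'.real (E₁ \ E₂) * μ'.real {ω | 2 ≤ ((A₁.filter fun a => inS S₁ v₁ ω ∈ openConn v₁ a).card + b₁)} +
      μ'.real (E₂ \ E₁) * μ'.real {ω | 2 ≤ ((A₂.filter fun a => inS S₂ v₂ ω ∈ openConn v₂ a).card + b₂)} +
      μ'.real (E₁ ∩ E₂) * μ'.real {ω | 2 ≤ ((A₁.filter fun a => inS S₁ v₁ ω ∈ openConn v₁ a).card + b₁)} +
      μ'.real (E₁ ∩ E₂) * μ'.real {ω | ((A₁.filter fun a => inS S₁ v₁ ω ∈ openConn v₁ a).card + b₁) = 1} *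
        μ'.real {ω | 1 ≤ ((A₂.filter fun a => inS S₂ v₂ ω ∈ openConn v₂ a).card + b₂)} +
      μ'.real (E₁ ∩ E₂) * μ'.real {ω | ((A₁.filter fun a => inS S₁ v₁ ω ∈ openConn v₁ a).card + b₁) = 0} *
        μ'.real {ω | 2 ≤ ((A₂.filter fun a => inS S₂ v₂ ω ∈ openConn v₂ a).card + b₂)} at h
    rw [h, h10', h01', hp', hd₁', hd₂', hs₁', hu₂', hz₁', hz, hu, hu']; ring
  -- the least internal tip marginal
  set τ : Fin n → ℝ := fun a => μ.real {ω | onZ Z ω ∈ openConn c a} with hτ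
  obtain ⟨a₀, ha₀, hmin⟩ := (A ∩ Z).exists_min_image τ hAZ
  set q := τ a₀ with hq
  have hq1 : q ≤ 1 := measureReal_le_one
  -- `q ≤ mᵢ uᵢ` through a relay of the hub `Sᵢ`
  have hhub₁ : ∀ {a : Fin n} (b : ℕ), a ∈ A₁ →
      τ a ≤ μ.real {ω | core Z (S₁ ∪ S₂) ω ∈ openConn c v₁} * μ.real {ω | 1 ≤ (A₁.filter fun a' => inS S₁ v₁ ω ∈ openConn v₁ a').card + b} := by
    intro a b ha
    have h1 : τ a = μ.real {ω | core Z (S₁ ∪ S₂) ω ∈ openConn c v₁} * μ.real {ω | inS S₁ v₁ ω ∈ openConn v₁ a} :=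
      real_onReach_hub₁ H w hwS₁ hwS₂ (by rw [hA₁def] at ha; exact (mem_inter.1 ha).2)
    rw [h1]
    refine mul_le_mul_of_nonneg_left (measureReal_mono (fun ω hω => ?_)) measureReal_nonneg
    simp only [mem_setOf_eq] at hω ⊢
    have hpos : 0 < (A₁.filter fun a' => inS S₁ v₁ ω ∈ openConn v₁ a').card := Finset.card_pos.2 ⟨a, mem_filter.2 ⟨ha, hω⟩⟩
    omega
  have hhub₂ : ∀ {a : Fin n} (b : ℕ), a ∈ A₂ →
      τ a ≤ μ.real {ω | core Z (S₁ ∪ S₂) ω ∈ openConn c v₂} * μ.real {ω | 1 ≤ (A₂.filter fun a' => inS S₂ v₂ ω ∈ openConn v₂ a').card + b} := by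
    intro a b ha
    have h1 : τ a = μ.real {ω | core Z (S₁ ∪ S₂) ω ∈ openConn c v₂} * μ.real {ω | inS S₂ v₂ ω ∈ openConn v₂ a} :=
      real_onReach_hub₂ H w hwS₁ hwS₂ (by rw [hA₂def] at ha; exact (mem_inter.1 ha).2)
    rw [h1]
    refine mul_le_mul_of_nonneg_left (measureReal_mono (fun ω hω => ?_)) measureReal_nonneg
    simp only [mem_setOf_eq] at hω ⊢
    have hpos : 0 < (A₂.filter fun a' => inS S₂ v₂ ω ∈ openConn v₂ a').card := Finset.card_pos.2 ⟨a, mem_filter.2 ⟨ha, hω⟩⟩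
    omega
  have hsd₁ : s₁ + d₁ ≤ 1 := by rw [← hu]; exact hu₁1
  have hsd₂ : s₂ + d₂ ≤ 1 := by rw [← hu']; exact hu₂1
  -- an unloaded anchor has a trivial bundle
  have hempty : ∀ {S : Finset (Fin n)} {v : Fin n} {B : Finset (Fin n)} {b : ℕ} (P : ℕ → Prop), B = ∅ → b = 0 → ¬ P 0 →
      μ.real {ω : BondConfig (Fin n) | P ((B.filter fun a => inS S v ω ∈ openConn v a).card + b)} = 0 := by
    intro S v B b P hB hb hP
    have : {ω : BondConfig (Fin n) | P ((B.filter fun a => inS S v ω ∈ openConn v a).card + b)} = ∅ := by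
      ext ω
      simp only [hB, hb, Finset.filter_empty, Finset.card_empty, Nat.add_zero, mem_setOf_eq, Set.mem_empty_iff_false, iff_false]
      exact hP
    rw [this, measureReal_empty]
  -- a relay anchor: internal marginal `mᵢ`, loaded count `≥ 1` surely
  have hanchor : ∀ {v : Fin n}, v ∉ S₁ → v ∉ S₂ → τ v = μ.real {ω | core Z (S₁ ∪ S₂) ω ∈ openConn c v} := fun {v} hv₁ hv₂ =>
    real_onReach_anchor H w hwS₁ hwS₂ hv₁ hv₂
  have hfull : ∀ {S : Finset (Fin n)} {v : Fin n} {B : Finset (Fin n)} {b : ℕ}, b = 1 →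
      μ.real {ω : BondConfig (Fin n) | 1 ≤ (B.filter fun a => inS S v ω ∈ openConn v a).card + b} = 1 := by
    intro S v B b hb
    have : {ω : BondConfig (Fin n) | 1 ≤ (B.filter fun a => inS S v ω ∈ openConn v a).card + b} = Set.univ := by
      ext ω; simp only [mem_setOf_eq, Set.mem_univ, iff_true]; omega
    rw [this, probReal_univ]
  -- domination: both anchors loaded (real algebra) or one anchor loaded (the internal numbers coincide)
  have hdom : ∃ lam : ℝ, 0 ≤ lam ∧ lam ≤ 1 ∧ lam * hP + (1 - lam) * q ≤ hS ∧ lam * tP + (1 - lam) * q ≤ tS := by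
    -- `q ≤ mᵢ uᵢ` for a loaded anchor
    have hq₁' : A₁.Nonempty ∨ v₁ ∈ A → q ≤ m₁ * (s₁ + d₁) := by
      rintro (⟨ℓ₁, hℓ₁⟩ | hv)
      · rw [← hu]
        have hℓ₁' : ℓ₁ ∈ A ∩ S₁ := by rw [hA₁def] at hℓ₁; exact hℓ₁
        exact (hmin ℓ₁ (mem_inter.2 ⟨(mem_inter.1 hℓ₁').1, H.S₁Z (mem_inter.1 hℓ₁').2⟩)).trans (hhub₁ b₁ hℓ₁)
      · have hb : b₁ = 1 := by rw [hb₁, if_pos hv]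
        have hu1 : u₁ = 1 := hfull hb
        have hτ1 : τ v₁ = m₁ := hanchor H.v₁S₁ H.v₁S₂
        rw [← hu, hu1, mul_one, ← hτ1]
        exact hmin v₁ (mem_inter.2 ⟨hv, H.v₁Z⟩)
    have hq₂' : A₂.Nonempty ∨ v₂ ∈ A → q ≤ m₂ * (s₂ + d₂) := by
      rintro (⟨ℓ₂, hℓ₂⟩ | hv)
      · rw [← hu']
        have hℓ₂' : ℓ₂ ∈ A ∩ S₂ := by rw [hA₂def] at hℓ₂; exact hℓ₂
        exact (hmin ℓ₂ (mem_inter.2 ⟨(mem_inter.1 hℓ₂').1, H.S₂Z (mem_inter.1 hℓ₂').2⟩)).trans (hhub₂ b₂ hℓ₂)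
      · have hb : b₂ = 1 := by rw [hb₂, if_pos hv]
        have hu2 : u₂ = 1 := hfull hb
        have hτ2 : τ v₂ = m₂ := hanchor H.v₂S₁ H.v₂S₂
        rw [← hu', hu2, mul_one, ← hτ2]
        exact hmin v₂ (mem_inter.2 ⟨hv, H.v₂Z⟩)
    by_cases hl₁ : A₁.Nonempty ∨ v₁ ∈ A
    · by_cases hl₂ : A₂.Nonempty ∨ v₂ ∈ A
      · exact twoAnchor_dominates m₁ m₂ p s₁ d₁ s₂ d₂ q hS tS hP tP hm₁0 hm₂0 hp₁ hp₂ hpm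
          hs₁0 hd₁0 hs₂0 hd₂0 hsd₁ hsd₂ (hq₁' hl₁) (hq₂' hl₂) fS fT fP fQ
      · rw [not_or] at hl₂
        have hA₂e : A₂ = ∅ := Finset.not_nonempty_iff_eq_empty.1 hl₂.1
        have hb : b₂ = 0 := by rw [hb₂, if_neg hl₂.2]
        have hs₂z : s₂ = 0 := hempty (fun k => k = 1) hA₂e hb (by norm_num)
        have hd₂z : d₂ = 0 := hempty (fun k => 2 ≤ k) hA₂e hb (by norm_num)
        have e1 : hS = hP := by rw [fS, fP, hs₂z, hd₂z]; ring
        have e2 : tS = tP := by rw [fT, fQ, hs₂z, hd₂z]; ring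
        exact ⟨1, zero_le_one, le_refl _, by rw [e1]; linarith, by rw [e2]; linarith⟩
    · rw [not_or] at hl₁
      have hA₁e : A₁ = ∅ := Finset.not_nonempty_iff_eq_empty.1 hl₁.1
      have hb : b₁ = 0 := by rw [hb₁, if_neg hl₁.2]
      have hs₁z : s₁ = 0 := hempty (fun k => k = 1) hA₁e hb (by norm_num)
      have hd₁z : d₁ = 0 := hempty (fun k => 2 ≤ k) hA₁e hb (by norm_num)
      have e1 : hS = hP := by rw [fS, fP, hs₁z, hd₁z]; ring
      have e2 : tS = tP := by rw [fT, fQ, hs₁z, hd₁z]; ring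
      exact ⟨1, zero_le_one, le_refl _, by rw [e1]; linarith, by rw [e2]; linarith⟩
  obtain ⟨lam, hlam0, hlam1, hdomh, hdomt⟩ := hdom
  exact real_card_le_one_le_of_dominates w w' ho H.cZ hwZ (hdecouple_block_vanish H w) (fun e he => (hdecouple_of_avoid w he).symm)
    A t q lam hlam0 hlam1 hq1 ha₀ (le_refl _) (hcut a₀ ha₀) hdomh hdomt hfar'

/-! ## Marginals are preserved; the layer-one FAR instance transfers -/

/-- **Hub-decoupling preserves the relay marginals**: `P_{w'}(o ↔ a) = P_w(o ↔ a)` for `a ∈ A`. [this work] -/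
theorem real_openConn_hdecouple_eq (H : IsTwoHub c v₁ v₂ Z S₁ S₂) (w : Sym2 (Fin n) → unitInterval) (ho : o ∉ Z)
    (hwZ : ∀ x y : Fin n, x ≠ y → x ∈ Z → y ∉ Z → y ≠ c → (w s(x, y) : ℝ) = 0)
    (hwS₁ : ∀ x y : Fin n, x ≠ y → x ∈ S₁ → y ∉ S₁ → y ≠ v₁ → (w s(x, y) : ℝ) = 0)
    (hwS₂ : ∀ x y : Fin n, x ≠ y → x ∈ S₂ → y ∉ S₂ → y ≠ v₂ → (w s(x, y) : ℝ) = 0)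
    {A : Finset (Fin n)} (hA : A ∩ Z ⊆ S₁ ∪ S₂ ∪ {v₁, v₂}) {a : Fin n} (ha : a ∈ A) :
    (prodBernoulli (hdecouple c v₁ v₂ Z S₁ S₂ w)).real (openConn o a) = (prodBernoulli w).real (openConn o a) := by
  have hw'Z := hdecouple_block_vanish H w
  have hw'S₁ := hdecouple_hub_vanish₁ H w
  have hw'S₂ := hdecouple_hub_vanish₂ H w
  have hagree : ∀ e ∈ avoid Z, w e = hdecouple c v₁ v₂ Z S₁ S₂ w e := fun e he => (hdecouple_of_avoid w he).symm
  by_cases haZ : a ∈ Z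
  · rw [real_openConn_in_eq (hdecouple c v₁ v₂ Z S₁ S₂ w) ho H.cZ hw'Z haZ, real_openConn_in_eq w ho H.cZ hwZ haZ,
      ← real_offZ_event_eq_of_agree w (hdecouple c v₁ v₂ Z S₁ S₂ w) Z hagree (fun η => η ∈ openConn o c)]
    by_cases ha₁ : a ∈ S₁
    · rw [real_onReach_hub₁ H _ hw'S₁ hw'S₂ ha₁, real_onReach_hub₁ H w hwS₁ hwS₂ ha₁, real_coreReach_hdecouple₁ H w,
        real_inS_hdecouple₁ H w (fun η => η ∈ openConn v₁ a)]
    · by_cases ha₂ : a ∈ S₂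
      · rw [real_onReach_hub₂ H _ hw'S₁ hw'S₂ ha₂, real_onReach_hub₂ H w hwS₁ hwS₂ ha₂, real_coreReach_hdecouple₂ H w,
          real_inS_hdecouple₂ H w (fun η => η ∈ openConn v₂ a)]
      · -- an anchor
        have h := hA (Finset.mem_inter.2 ⟨ha, haZ⟩)
        rw [Finset.mem_union, Finset.mem_union, Finset.mem_insert, Finset.mem_singleton] at h
        rw [real_onReach_anchor H _ hw'S₁ hw'S₂ ha₁ ha₂, real_onReach_anchor H w hwS₁ hwS₂ ha₁ ha₂]
        rcases h with (h | h) | rfl | rfl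
        · exact absurd h ha₁
        · exact absurd h ha₂
        · rw [real_coreReach_hdecouple₁ H w]
        · rw [real_coreReach_hdecouple₂ H w]
  · rw [real_openConn_off_eq (c := c) (hdecouple c v₁ v₂ Z S₁ S₂ w) ho hw'Z haZ, real_openConn_off_eq (c := c) w ho hwZ haZ,
      ← real_offZ_event_eq_of_agree w (hdecouple c v₁ v₂ Z S₁ S₂ w) Z hagree (fun η => η ∈ openConn o a)]

/-- **The layer-one FAR instance transfers from the hub-decoupled graph.** [this work] -/
theorem farLayerOne_twoHub (H : IsTwoHub c v₁ v₂ Z S₁ S₂) (w : Sym2 (Fin n) → unitInterval) (ho : o ∉ Z)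
    (hwZ : ∀ x y : Fin n, x ≠ y → x ∈ Z → y ∉ Z → y ≠ c → (w s(x, y) : ℝ) = 0)
    (hwS₁ : ∀ x y : Fin n, x ≠ y → x ∈ S₁ → y ∉ S₁ → y ≠ v₁ → (w s(x, y) : ℝ) = 0)
    (hwS₂ : ∀ x y : Fin n, x ≠ y → x ∈ S₂ → y ∉ S₂ → y ≠ v₂ → (w s(x, y) : ℝ) = 0)
    (A : Finset (Fin n)) (hA : A ∩ Z ⊆ S₁ ∪ S₂ ∪ {v₁, v₂}) (hAZ : (A ∩ Z).Nonempty) (t : ℝ)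
    (hfar' : (2 : ℝ) < ∑ a ∈ A, (prodBernoulli (hdecouple c v₁ v₂ Z S₁ S₂ w)).real (openConn o a) →
      (∀ a ∈ A, (prodBernoulli (hdecouple c v₁ v₂ Z S₁ S₂ w)).real (openConn o a)ᶜ ≤ t) →
      (prodBernoulli (hdecouple c v₁ v₂ Z S₁ S₂ w)).real {ω : BondConfig (Fin n) | (A.filter fun a => ω ∈ openConn o a).card ≤ 1} ≤ t)
    (hsum : (2 : ℝ) < ∑ a ∈ A, (prodBernoulli w).real (openConn o a))
    (hcut : ∀ a ∈ A, (prodBernoulli w).real (openConn o a)ᶜ ≤ t) :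
    (prodBernoulli w).real {ω : BondConfig (Fin n) | (A.filter fun a => ω ∈ openConn o a).card ≤ 1} ≤ t := by
  have hmeas : ∀ U : Set (BondConfig (Fin n)), MeasurableSet U := fun U => (Set.toFinite U).measurableSet
  have hmarg : ∀ a ∈ A, (prodBernoulli (hdecouple c v₁ v₂ Z S₁ S₂ w)).real (openConn o a) = (prodBernoulli w).real (openConn o a) :=
    fun a ha => real_openConn_hdecouple_eq H w ho hwZ hwS₁ hwS₂ hA ha
  have hsum' : (2 : ℝ) < ∑ a ∈ A, (prodBernoulli (hdecouple c v₁ v₂ Z S₁ S₂ w)).real (openConn o a) := by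
    rw [Finset.sum_congr rfl hmarg]; exact hsum
  have hcut' : ∀ a ∈ A, (prodBernoulli (hdecouple c v₁ v₂ Z S₁ S₂ w)).real (openConn o a)ᶜ ≤ t := by
    intro a ha
    rw [probReal_compl_eq_one_sub (hmeas _), hmarg a ha, ← probReal_compl_eq_one_sub (hmeas _)]
    exact hcut a ha
  exact real_card_le_one_le_twoHub H w ho hwZ hwS₁ hwS₂ A hA hAZ t (fun a ha => hcut a (Finset.mem_inter.1 ha).1)
    (hfar' hsum' hcut')


end Block

end Quant

end Summit.CriticalPhenomena.PercolationContinuityZ3.Theorems
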